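import Literature.NumberTheory.Automorphic.AshSmithTheoryHecke
import Literature.NumberTheory.GaloisRepresentations.AbsIntegersEquiv
import HarnessLib

/-!
# Ash (2003), *Smith theory and Hecke operators* — proofs towards the named fact
# `Ash2003_inducedRayClassCharacter_attached`: the Galois side, I (unramifiedness of `Ind ϑ`)

Topic `NumberTheory/Automorphic`; companion ("`Proofs`" sibling) of
`Literature.NumberTheory.Automorphic.AshSmithTheoryHecke`, which vendors Theorem 1.1 / Corollary 4.4
of A. Ash, *Smith theory and Hecke operators*, J. Algebra **259** (2003) 43–58 [Ash2003] as the named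
fact `Ash2003_inducedRayClassCharacter_attached`.

The printed proof has two halves: the existence of a Hecke eigenclass with the explicit
eigencharacter `χ_θ` (Smith theory on the locally symmetric space, §§2–6 of the paper), and the
statement that `ρ_θ = Ind_{G_L}^{G_ℚ} θ` is attached to `χ_θ` (Lemma 4.2, from Ash, Duke Math. J. 65
(1992), Thm. 6.1.2), whose content is: `ρ_θ` is unramified at every `l ∤ pM` and
`det(1 - ρ_θ(Frob_l) X) = ∏_{λ ∣ l} (1 - θ([λ]) X^{f})`.  This file proves the **first clause of the
Galois half** in the tree's typing (`Ash2003.IsAttached`, first conjunct): for a ray class character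
`θ` of `L = ℚ(ζ_p)` modulo `(pN)` with Galois avatar `ϑ` (`Ash2003.IsGaloisAvatar`), the induced
representation `Ind_{Γ_L}^{Γ_ℚ} ϑ` (`FramedGaloisRep.induce`) is unramified at every finite place `v`
of `ℚ` with `q_v ∤ p · (pN)` (`Ash2003.isUnramifiedAt_induce_of_isGaloisAvatar`).

## The argument (standard; Serre, *Linear representations of finite groups*, §3.3 (matrix form of
## `Ind`); Neukirch, *Algebraic Number Theory*, I §9)

Let `𝔓 ∣ v` be a prime of `\bar ℤ` and `σ ∈ I_𝔓 ≤ Γ_ℚ`.  In the matrix form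
`Ind(ϑ)(σ) = (ϑ̇(rᵢ⁻¹ σ rⱼ))ᵢⱼ` (`indMatrix`):
* each diagonal conjugate `rᵢ⁻¹ σ rᵢ` lies in the inertia group of the prime `rᵢ⁻¹ 𝔓 ∣ v`
  (`Ideal.conj_mem_inertia_smul_iff`), which is contained in `res(Γ_L)` because `l = q_v ≠ p` is
  unramified in `L = ℚ(ζ_p)`: an element of inertia at a prime not above `p` fixes the `p`-th roots
  of unity (`smul_eq_self_of_mem_inertia_of_pow_prime_pow_eq_one`), hence fixes `L = ℚ(ζ_p)`
  pointwise (`IsCyclotomicExtension.adjoin_primitive_root_eq_top`), i.e. lies in `res(Γ_L)`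
  (`mem_range_absGaloisRestrict_iff_smul_absEmbedding`) — `inertia_le_range_absGaloisRestrict_cyclotomicField`;
  writing `rᵢ⁻¹ σ rᵢ = res(τᵢ)`, `τᵢ` lies in the inertia group of the corresponding prime `𝔔ᵢ` of
  `\bar ℤ_L` (`comap_inertia_comap_absIntegersMap`), above a place `wᵢ ∣ v` of `L`, and `ϑ(τᵢ) = 1`
  because `ϑ` is unramified at `wᵢ ∤ (pN)` (`IsGaloisAvatar`);
* the off-diagonal blocks vanish: `rᵢ⁻¹ σ rⱼ ∈ res(Γ_L)` together with `rⱼ⁻¹ σ rⱼ ∈ res(Γ_L)` forces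
  `rᵢ⁻¹ rⱼ ∈ res(Γ_L)`, i.e. `i = j` (`indMatrix_eq_one_of_forall_exists`).
Hence `Ind(ϑ)(σ) = 1`.  The general statement, for any finite extension of number fields `F/K`, any
framed `ρ : Γ_F → GL_n(A)` unramified above `v` and any `v` whose inertia groups lie in `res(Γ_F)`,
is `FramedGaloisRep.isUnramifiedAt_induce` (a dot-notation extension of the accepted
`GaloisRepresentations.FramedGaloisRep`, declared here by absolute name, CONVENTIONS §2).

## What is NOT here

The second clause of the Galois half (the Frobenius characteristic polynomial of `Ind ϑ`), and the
automorphic half of [Ash2003] (existence of the eigenclass: Smith theory on `X(M)`, Lemmas 2.1–4.1,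
5.7, Thm. 6.2), for which the tree has no topological model of `X(M)` (its cohomology is *defined*
as group cohomology, `ArithmeticQuotient.cohomology`).

## References

* A. Ash, *Smith theory and Hecke operators*, J. Algebra 259 (2003) 43–58, Def. 0.1, Lemma 4.2
  [Ash2003].
* J.-P. Serre, *Linear representations of finite groups*, GTM 42 (1977), §3.3
  [SerreLinearRepresentations1977].
* J. Neukirch, *Algebraic Number Theory* (1999), Ch. I §9 (conjugate primes, inertia groups)
  [NeukirchANT1999].
-/

noncomputable section

open scoped NumberField Pointwise
open IsDedekindDomain Polynomial Field

/-! ### Block matrices of induced representations equal to `1` -/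

namespace Literature.NumberTheory.Automorphic

namespace Ash2003

section IndMatrixOne

variable {H G R : Type*} [Group H] [Group G] {ι : Type*}

/-- **`Ind(π)(g) = 1` when the diagonal conjugates are trivial.**  For the block matrix
`Ind(π)(g) = (π̇(rᵢ⁻¹ g rⱼ))ᵢⱼ` of the matrix form of an induced representation
(`GaloisRepresentations.indMatrix`): if every diagonal conjugate `rᵢ⁻¹ g rᵢ` is of the form `φ(aᵢ)`
with `π(aᵢ) = 1`, then `Ind(π)(g)` is the identity — the diagonal blocks are `π(aᵢ) = 1`, and an
off-diagonal `rᵢ⁻¹ g rⱼ ∈ φ(H)` would give `rᵢ⁻¹ rⱼ = (rᵢ⁻¹ g rⱼ)(rⱼ⁻¹ g rⱼ)⁻¹ ∈ φ(H)`, i.e. `i = j`.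
Ref: Serre, *Linear representations of finite groups*, §3.3, proof of Thm. 12. [folklore] -/
theorem indMatrix_eq_one_of_forall_exists [MulZeroOneClass R] [DecidableEq ι] {φ : H →* G}
    (hφ : Function.Injective φ) (π : H →* R) {r : ι → G}
    (hr : Function.Injective fun i => (r i : G ⧸ φ.range)) {g : G}
    (h : ∀ i, ∃ a : H, φ a = (r i)⁻¹ * g * r i ∧ π a = 1) :
    GaloisRepresentations.indMatrix φ π r g = 1 := by
  ext i j
  rw [GaloisRepresentations.indMatrix_apply, Matrix.one_apply]
  split_ifs with hij
  · subst hij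
    obtain ⟨a, ha, hπa⟩ := h i
    rw [← ha, GaloisRepresentations.dotExtend_apply_map hφ, hπa]
  · refine GaloisRepresentations.dotExtend_of_not_mem φ π fun hmem => hij (hr ?_)
    obtain ⟨a, ha, -⟩ := h j
    change (r i : G ⧸ φ.range) = (r j : G ⧸ φ.range)
    rw [QuotientGroup.eq]
    have h2 : (r j)⁻¹ * g * r j ∈ φ.range := ⟨a, ha⟩
    have h3 := φ.range.mul_mem hmem (φ.range.inv_mem h2)
    convert h3 using 1
    group

end IndMatrixOne

section FramedOne

variable {H : Type*} {G : Type*} [Group H] [TopologicalSpace H] [Group G] [TopologicalSpace G]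
  [IsTopologicalGroup G] {A : Type*} [CommRing A] [TopologicalSpace A] {n m : ℕ}
  {ι : Type*} [Fintype ι] [DecidableEq ι]

/-- **`Ind(ρ)(g) = 1` for a framed representation** when every diagonal conjugate `rᵢ⁻¹ g rᵢ` is
`φ(aᵢ)` with `ρ(aᵢ) = 1` (`indMatrix_eq_one_of_forall_exists`, flattened and relabelled).
Ref: Serre, *Linear representations of finite groups*, §3.3, proof of Thm. 12. [folklore] -/
theorem framedRepInduce_apply_eq_one (φ : H →* G) (hφ : Topology.IsOpenEmbedding φ) (r : ι → G)
    (hr : Function.Bijective fun i => (r i : G ⧸ φ.range)) (e : ι × Fin n ≃ Fin m)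
    (ρ : GaloisRepresentations.FramedRep H A n) {g : G}
    (h : ∀ i, ∃ a : H, φ a = (r i)⁻¹ * g * r i ∧ ρ a = 1) :
    GaloisRepresentations.FramedRep.induce φ hφ r hr e ρ g = 1 := by
  refine Units.ext ?_
  rw [GaloisRepresentations.FramedRep.induce_apply_coe, Units.val_one]
  change ((Matrix.compRingEquiv ι (Fin n) A).trans (Matrix.reindexRingEquiv A e)).toRingHom
      (GaloisRepresentations.indMatrixHom hφ.injective
        (GaloisRepresentations.FramedRep.toMatrixHom ρ) r hr g) = 1
  rw [GaloisRepresentations.indMatrixHom_apply,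
    indMatrix_eq_one_of_forall_exists hφ.injective _ hr.1, map_one]
  intro i
  obtain ⟨a, ha, hρa⟩ := h i
  exact ⟨a, ha, by rw [GaloisRepresentations.FramedRep.toMatrixHom_apply, hρa, Units.val_one]⟩

end FramedOne

end Ash2003

end Literature.NumberTheory.Automorphic

/-! ### Unramifiedness of induced Galois representations -/

namespace Literature.NumberTheory.GaloisRepresentations

section Induce

universe u v

variable (K : Type u) {F : Type v} [Field K] [NumberField K] [Field F] [Algebra K F]
  [FiniteDimensional K F] {A : Type*} [CommRing A] [TopologicalSpace A] {n d : ℕ}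

/-- **`Ind_{Γ_F}^{Γ_K} ρ` is unramified at `v`** when `ρ` is unramified at every place `w ∣ v` of `F`
and `v` is unramified in `F/K` in the Galois-theoretic sense that every inertia group `I_𝔓 ≤ Γ_K`,
`𝔓 ∣ v`, lies in `res(Γ_F)`.  Proof: module docstring (diagonal conjugates `rᵢ⁻¹ σ rᵢ ∈ I_{rᵢ⁻¹𝔓}`
restrict to inertia elements of `Γ_F` above `v`, killed by `ρ`; off-diagonal blocks vanish).
Dot-notation extension of the accepted `FramedGaloisRep` (`GaloisRepresentations/GaloisRep.lean`,
`InducedGaloisRep.lean`), declared from `Automorphic/AshSmithTheoryHeckeProofs.lean` by absolute name.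
Ref: Serre, *Linear representations of finite groups*, §3.3; Neukirch, *Algebraic Number Theory*,
I §9. [folklore] -/
theorem FramedGaloisRep.isUnramifiedAt_induce (hd : Module.finrank K F = d)
    (ρ : FramedGaloisRep F A n) {v : HeightOneSpectrum (𝓞 K)}
    (hI : ∀ 𝔓 ∈ v.primesAbove,
      𝔓.inertia (absoluteGaloisGroup K) ≤ (absGaloisRestrict K F).range)
    (hρ : ∀ w : HeightOneSpectrum (𝓞 F), w.asIdeal.under (𝓞 K) = v.asIdeal → ρ.IsUnramifiedAt w) :
    (ρ.induce K hd).IsUnramifiedAt v := by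
  intro 𝔓 h𝔓 σ hσ
  rw [FramedGaloisRep.induce_def]
  refine Automorphic.Ash2003.framedRepInduce_apply_eq_one _ _ _ _ _ ρ fun i => ?_
  set r := absGaloisCosetRep K F hd i with hr
  -- `r⁻¹ σ r ∈ I_{r⁻¹ 𝔓}`, a prime above `v`
  have h𝔓' : r⁻¹ • 𝔓 ∈ v.primesAbove := smul_mem_primesAbove h𝔓 r⁻¹
  have hσ' : r⁻¹ * σ * r ∈ (r⁻¹ • 𝔓).inertia (absoluteGaloisGroup K) := by
    have := (Ideal.conj_mem_inertia_smul_iff 𝔓 r⁻¹ σ).mpr hσ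
    rwa [inv_inv] at this
  obtain ⟨a, ha⟩ := hI _ h𝔓' hσ'
  refine ⟨a, ha, ?_⟩
  -- transport the prime `r⁻¹ 𝔓` to `\bar ℤ_F`
  haveI : (r⁻¹ • 𝔓).IsPrime := h𝔓'.1
  set 𝔔 : Ideal (absIntegers (𝓞 F) F) :=
    (r⁻¹ • 𝔓).comap ((absIntegersEquiv K F).symm : absIntegers (𝓞 F) F →+* absIntegers (𝓞 K) K)
    with h𝔔
  have h𝔔c : 𝔔.comap (absIntegersMap K F) = r⁻¹ • 𝔓 := by
    rw [h𝔔, ← coe_absIntegersEquiv]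
    exact Ideal.comap_of_equiv _
  haveI : 𝔔.IsPrime := Ideal.comap_isPrime _ _
  have h𝔔v : 𝔔.comap (absIntegersMap K F) ∈ v.primesAbove := by
    rw [h𝔔c]
    exact h𝔓'
  obtain ⟨w, hw, h𝔔w, -⟩ := exists_heightOneSpectrum_of_comap_absIntegersMap_mem_primesAbove h𝔔v
  have haI : a ∈ 𝔔.inertia (absoluteGaloisGroup F) := by
    rw [← comap_inertia_comap_absIntegersMap K F 𝔔, Subgroup.mem_comap, h𝔔c]
    change (absGaloisRestrict K F).toMonoidHom a ∈ _
    rw [ha]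
    exact hσ'
  exact hρ w hw 𝔔 h𝔔w a haI

end Induce

end Literature.NumberTheory.GaloisRepresentations

/-! ### Places of `ℚ` away from `p`: inertia lies in `Γ_{ℚ(ζ_p)}` -/

namespace Literature.NumberTheory.Automorphic

namespace Ash2003

/-- If a natural number `m` lies in the finite place `v` of `ℚ` then the residue characteristic
`q_v` divides `m` (`N(v) ∣ N((m)) = m`; Mathlib `Ideal.absNorm_dvd_absNorm_of_le`,
`Ideal.absNorm_span_singleton`, `Algebra.norm_algebraMap`). [folklore] -/
theorem residueCard_dvd_of_natCast_mem {v : HeightOneSpectrum (𝓞 ℚ)} {m : ℕ}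
    (hm : (m : 𝓞 ℚ) ∈ v.asIdeal) : v.residueCard ∣ m := by
  have h1 : Ideal.absNorm v.asIdeal ∣ Ideal.absNorm (Ideal.span {(m : 𝓞 ℚ)}) :=
    Ideal.absNorm_dvd_absNorm_of_le ((Ideal.span_singleton_le_iff_mem _).mpr hm)
  rw [Ideal.absNorm_span_singleton, show (m : 𝓞 ℚ) = algebraMap ℤ (𝓞 ℚ) (m : ℤ) by simp,
    Algebra.norm_algebraMap, NumberField.RingOfIntegers.rank, Module.finrank_self, pow_one,
    Int.natAbs_natCast] at h1
  exact h1

/-- **Inertia at `l ≠ p` lies in `Γ_{ℚ(ζ_p)}`** (`l` is unramified in `ℚ(ζ_p)`, Galois form): for a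
finite place `v` of `ℚ` with `p ∉ v` and a prime `𝔓 ∣ v` of `\bar ℤ`, the inertia group `I_𝔓 ≤ Γ_ℚ`
is contained in `res(Γ_L)`, `L = ℚ(ζ_p)`.  Proof: an element of `I_𝔓` fixes the `p`-th roots of unity
of `ℚ̄` (`GaloisRepresentations.smul_eq_self_of_mem_inertia_of_pow_prime_pow_eq_one`), so the
equaliser of `e : L → ℚ̄` and `σ ∘ e` (a subalgebra, Mathlib `AlgHom.equalizer`) contains `ζ_p`, hence
is all of `L = ℚ(ζ_p)` (`IsCyclotomicExtension.adjoin_primitive_root_eq_top`); an element fixing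
`e(L)` pointwise lies in `res(Γ_L)` (`mem_range_absGaloisRestrict_iff_smul_absEmbedding`).
Ref: Neukirch, *Algebraic Number Theory*, Ch. I (10.4) with §9 (cyclotomic fields are unramified
outside `p`); Washington, *Cyclotomic Fields*, Prop. 2.3. [folklore] -/
theorem inertia_le_range_absGaloisRestrict_cyclotomicField (p : ℕ) [hp : Fact p.Prime]
    {v : HeightOneSpectrum (𝓞 ℚ)} (hv : (p : 𝓞 ℚ) ∉ v.asIdeal)
    {𝔓 : Ideal (GaloisRepresentations.absIntegers (𝓞 ℚ) ℚ)} (h𝔓 : 𝔓 ∈ v.primesAbove) :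
    𝔓.inertia (absoluteGaloisGroup ℚ) ≤
      (GaloisRepresentations.absGaloisRestrict ℚ (CyclotomicField p ℚ)).range := by
  intro σ hσ
  haveI : NeZero p := ⟨hp.out.ne_zero⟩
  -- Mathlib's instance is stated for `CyclotomicField.instAlgebra`; the canonical `ℚ`-algebra
  -- structure `DivisionRing.toRatAlgebra` agrees with it definitionally (not reducibly).
  haveI : IsCyclotomicExtension {p} ℚ (CyclotomicField p ℚ) :=
    CyclotomicField.isCyclotomicExtension p ℚ
  set ζ := IsCyclotomicExtension.zeta p ℚ (CyclotomicField p ℚ) with hζdef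
  have hζ : IsPrimitiveRoot ζ p := IsCyclotomicExtension.zeta_spec p ℚ (CyclotomicField p ℚ)
  set e := GaloisRepresentations.absEmbedding ℚ (CyclotomicField p ℚ) with he
  -- `σ` fixes `e(ζ)`, a `p`-th root of unity, since `p ∉ v`
  have hfix : σ • e ζ = e ζ := by
    refine GaloisRepresentations.smul_eq_self_of_mem_inertia_of_pow_prime_pow_eq_one
      (ℓ := p) (n := 1) hv h𝔓 hσ ?_
    rw [pow_one, ← map_pow, hζ.pow_eq_one, map_one]
  -- the equaliser of `σ ∘ e` and `e` is a subalgebra containing `ζ`, hence everything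
  let S : Subalgebra ℚ (CyclotomicField p ℚ) :=
    AlgHom.equalizer ((absoluteGaloisGroup.toAlgEquiv ℚ σ).toAlgHom.comp e) e
  have hζS : ζ ∈ S := (AlgHom.mem_equalizer _ _ _).mpr hfix
  have hS : Algebra.adjoin ℚ {ζ} ≤ S := Algebra.adjoin_le (Set.singleton_subset_iff.mpr hζS)
  rw [IsCyclotomicExtension.adjoin_primitive_root_eq_top hζ] at hS
  rw [GaloisRepresentations.mem_range_absGaloisRestrict_iff_smul_absEmbedding]
  intro x
  exact (AlgHom.mem_equalizer _ _ _).mp (hS (Algebra.mem_top (x := x)))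

/-! ### The Galois half of [Ash2003, Lemma 4.2], first clause: `Ind ϑ` is unramified outside `pN` -/

/-- **`ρ = Ind_{Γ_L}^{Γ_ℚ} ϑ` is unramified at every `l ∤ pM`** (`L = ℚ(ζ_p)`, `M = pN`): the first
clause of "`ρ_θ` is attached" ([Ash2003, Def. 0.1]; Lemma 4.2) for the Galois avatar `ϑ` of a ray
class character `θ` of `L` modulo `(pN)` (`Ash2003.IsGaloisAvatar`), in the tree's typing — the first
conjunct of `Ash2003.IsAttached p (p * N) (Ind ϑ) a` in `Ash2003_inducedRayClassCharacter_attached`,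
for every finite place `v` of `ℚ` with `q_v ∤ p · (pN)`.  Proof: `q_v ≠ p`, so the inertia groups above
`v` lie in `res(Γ_L)` (`inertia_le_range_absGaloisRestrict_cyclotomicField`); every place `w ∣ v` of
`L` is coprime to `(pN)` (else `q_v ∣ pN`), so `ϑ` is unramified at `w` (`IsGaloisAvatar`); conclude by
`FramedGaloisRep.isUnramifiedAt_induce`. [cite: Ash2003, Def. 0.1 and Lemma 4.2] -/
theorem isUnramifiedAt_induce_of_isGaloisAvatar (p : ℕ) [hp : Fact p.Prime] {N : ℕ} (hN : N ≠ 0)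
    {F : Type*} [CommRing F] [TopologicalSpace F]
    (θ : GaloisRepresentations.RayClassGroup (modulus (CyclotomicField p ℚ) (p * N)) →* Fˣ)
    (ϑ : GaloisRepresentations.FramedGaloisRep (CyclotomicField p ℚ) F 1)
    (hϑ : IsGaloisAvatar
      (modulus_ne_bot (CyclotomicField p ℚ) (mul_ne_zero (Nat.Prime.ne_zero hp.out) hN)) θ ϑ)
    {v : HeightOneSpectrum (𝓞 ℚ)} (hv : ¬ v.residueCard ∣ p * (p * N)) :
    (GaloisRepresentations.FramedGaloisRep.induce ℚ (finrank_cyclotomicField p) ϑ).IsUnramifiedAt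
      v := by
  -- `p ∉ v`
  have hpv : (p : 𝓞 ℚ) ∉ v.asIdeal := fun h =>
    hv ((residueCard_dvd_of_natCast_mem h).trans (Dvd.intro _ rfl))
  refine GaloisRepresentations.FramedGaloisRep.isUnramifiedAt_induce ℚ (finrank_cyclotomicField p) ϑ
    (fun 𝔓 h𝔓 => inertia_le_range_absGaloisRestrict_cyclotomicField p hpv h𝔓) fun w hw => ?_
  refine (hϑ w ?_).1
  -- `w ∣ v` is coprime to `(pN)`, for otherwise `pN ∈ w ∩ ℤ = v` and `q_v ∣ pN`
  rw [Ideal.isCoprime_iff_sup_eq]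
  by_contra hne
  have hle : modulus (CyclotomicField p ℚ) (p * N) ≤ w.asIdeal := by
    have h1 := w.isMaximal.eq_of_le hne le_sup_left
    exact le_sup_right.trans h1.symm.le
  have hmem : ((p * N : ℕ) : 𝓞 (CyclotomicField p ℚ)) ∈ w.asIdeal :=
    hle (Ideal.mem_span_singleton_self _)
  have hmem' : ((p * N : ℕ) : 𝓞 ℚ) ∈ v.asIdeal := by
    rw [← hw, Ideal.under, Ideal.mem_comap, map_natCast]
    exact hmem
  exact hv ((residueCard_dvd_of_natCast_mem hmem').trans (Dvd.intro p (by ring)))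

end Ash2003

end Literature.NumberTheory.Automorphic
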